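import Mathlib
import HarnessLib
import Literature.Analysis.Calculus.SphereAngularRigidity
import Summits.NavierStokesRegularity.NavierStokesRegularity.Theorems.ThreadingFluxHorizonTowerFiniteTowerToolkit
import Summits.NavierStokesRegularity.NavierStokesRegularity.Theorems.UnthreadedDoorKinematicShadowPointSourceCalculus

/-!
# Crux `PoloidalLiouville` (stmt-NavierStokesRegularity-1222, wall W1), crux idea «horizon-threading-tower» (ns-idea-15):
# DIPOLE TOWERS `{1, m, n}` AT ORDER ONE — helper 3: a zonal function with vanishing meridional derivative is radial

ARM A (ns-exp-scalarLiouville g5), director KEY 2026-08-29T04:32:46Z (β), bottom-up helper for the third-shell step (S3) of «dipole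
towers decided at order one» (route ns-wall-eng-3 g3, TwoShellTowers-RESULTS §4b; plan in `pub/ns-exp-scalarLiouville/HANDOFF.md`).
In (S3) the two-term parity class reads `D·Q = 0` with `D = ⟪x, ∇B × a⟫` and `Q` zonal; excluding `Q ≡ 0` reduces, by linearity of the
zonal multiplier `M_G(x) = ‖x‖²⟪∇G(x), a⟫ − ⟪a, x⟫⟪∇G(x), x⟫ = ⟪∇G(x), ‖x‖² a − ⟪a,x⟫ x⟫` (the derivative of `G` along the MERIDIONAL
tangent field), to the statement proved here:
* `threeFrame_decomposition` — the unconditional vector identity `(‖x‖²|a×x|²) g = |a×x|²⟪g,x⟫ x + ‖x‖²⟪g, a×x⟫ (a×x) + ⟪g, V⟫ V`,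
  `V = ‖x‖² a − ⟪a,x⟫ x` (orthogonal frame `x, a × x, V` off the axis);
* `inner_cross_eq_zero_of_meridional` — off the axis, `∇G ⊥ a × x` and `∇G ⊥ V` force `∇G ∥ x`, i.e. `⟪b × x, ∇G⟫ = 0` for EVERY `b`;
* `rotInvariant_all_of_offAxis` — for `G ∈ C¹` this extends to the axis by continuity (the axis has empty interior);
* `sphereConst_of_rotInvariant_all` — then `G` is constant on spheres about `0` (circle constancy `eq_of_inner_cross_gradient_eq_zero` about
  an axis orthogonal to `y − y′`);
* ★ `eq_zero_of_zonal_meridional_odd` — if moreover `G(c y) = cⁿ G(y)` for all real `c` with `n` ODD, then `G ≡ 0` (`G(−y) = −G(y) = G(y)`).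

HONEST LABEL: helper lemmas toward a special case of a crux-idea conjecture; `HorizonTowerZonality`, `PoloidalLiouville` (1222) and NS
regularity are OPEN / NOT proved; nothing here is an NS statement.  `--supports stmt-NavierStokesRegularity-1222 --as helper`.
-/

-- the summit and its single sub-problem share the name (CONVENTIONS §1)
set_option linter.dupNamespace false

noncomputable section

namespace Summit.NavierStokesRegularity.NavierStokesRegularity.Theorems.PoloidalLiouville.HorizonTower

open Set Function Filter Topology InnerProductSpace
open scoped RealInnerProductSpace
open Literature.Analysis.FluidPDE
open Literature.Geometry.DiscreteGeometry (inner_fin3 norm_sq_fin3)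

section Meridional

/-- **The orthogonal frame `(x, a × x, V)`, `V = ‖x‖² a − ⟪a,x⟫ x`** (unconditional identity):
`(‖x‖² |a × x|²) g = |a × x|² ⟪g, x⟫ x + ‖x‖² ⟪g, a × x⟫ (a × x) + ⟪g, V⟫ V`. [folklore] -/
theorem threeFrame_decomposition (a x g : E3) :
    (‖x‖ ^ 2 * ‖cross a x‖ ^ 2) • g
      = (‖cross a x‖ ^ 2 * ⟪g, x⟫) • x + (‖x‖ ^ 2 * ⟪g, cross a x⟫) • cross a x
        + ⟪g, ‖x‖ ^ 2 • a - ⟪a, x⟫ • x⟫ • (‖x‖ ^ 2 • a - ⟪a, x⟫ • x) := by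
  obtain ⟨c0, c1, c2⟩ := cross_fin3 a x
  have hq : ‖cross a x‖ ^ 2 = ‖a‖ ^ 2 * ‖x‖ ^ 2 - ⟪a, x⟫ ^ 2 := Zonal.norm_cross_sq a x
  ext i
  fin_cases i <;>
  · simp only [PiLp.add_apply, PiLp.sub_apply, PiLp.smul_apply, smul_eq_mul, hq, norm_sq_fin3, inner_fin3, c0, c1, c2,
      Fin.zero_eta, Fin.mk_one, Fin.reduceFinMk, Fin.isValue]
    ring

/-- **Off the axis, `∇G ⊥ a × x` and `∇G ⊥ V` force `∇G ∥ x`**: then `⟪b × x, g⟫ = 0` for every `b`. [folklore] -/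
theorem inner_cross_eq_zero_of_meridional {a x g : E3} (hax : cross a x ≠ 0) (hrot : ⟪g, cross a x⟫ = 0)
    (hmer : ⟪g, ‖x‖ ^ 2 • a - ⟪a, x⟫ • x⟫ = 0) (b : E3) : ⟪cross b x, g⟫ = 0 := by
  have hx : x ≠ 0 := by
    rintro rfl
    apply hax
    have h0 : cross a ((0 : ℝ) • (0 : E3)) = 0 := by rw [KinematicShadow.PointSource.cross_smul_right, zero_smul]
    rwa [smul_zero] at h0
  have hcoef : ‖x‖ ^ 2 * ‖cross a x‖ ^ 2 ≠ 0 :=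
    mul_ne_zero (pow_ne_zero 2 (norm_ne_zero_iff.2 hx)) (pow_ne_zero 2 (norm_ne_zero_iff.2 hax))
  have hdec := threeFrame_decomposition a x g
  rw [hrot, hmer, mul_zero, zero_smul, zero_smul, add_zero, add_zero] at hdec
  -- `(‖x‖²|a×x|²) ⟪b × x, g⟫ = |a×x|²⟪g,x⟫ ⟪b × x, x⟫ = 0`
  have h := congrArg (fun v : E3 => ⟪cross b x, v⟫) hdec
  simp only [inner_smul_right] at h
  rw [Zonal.inner_cross_self_right b x, mul_zero] at h
  exact (mul_eq_zero.1 h).resolve_left hcoef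

/-- The axis of `a ≠ 0` has empty interior: every point is a limit of points off the axis (along any direction `u` with `a × u ≠ 0`).
[folklore] -/
theorem exists_dir_cross_ne_zero {a : E3} (ha : a ≠ 0) : ∃ u : E3, cross a u ≠ 0 := by
  obtain ⟨u, hu, hau⟩ := Literature.Analysis.Calculus.exists_unit_orthogonal (E := E3)
    (by rw [finrank_euclideanSpace_fin]; norm_num) a
  refine ⟨u, fun h => ?_⟩
  have hq : ‖cross a u‖ ^ 2 = ‖a‖ ^ 2 * ‖u‖ ^ 2 - ⟪a, u⟫ ^ 2 := Zonal.norm_cross_sq a u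
  rw [h, norm_zero, hu, hau] at hq
  have : ‖a‖ = 0 := by nlinarith [norm_nonneg a]
  exact ha (norm_eq_zero.1 this)

/-- **Continuity extension to the axis**: if `G ∈ C¹` and, OFF the axis of `a ≠ 0`, `∇G ⊥ a × x` and `∇G ⊥ V(x)`, then
`⟪b × x, ∇G(x)⟫ = 0` for all `b` and ALL `x`. [folklore] -/
theorem rotInvariant_all_of_offAxis {G : E3 → ℝ} {a : E3} (ha : a ≠ 0) (hG : ContDiff ℝ 1 G)
    (hrot : ∀ x : E3, cross a x ≠ 0 → ⟪gradient G x, cross a x⟫ = 0)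
    (hmer : ∀ x : E3, cross a x ≠ 0 → ⟪gradient G x, ‖x‖ ^ 2 • a - ⟪a, x⟫ • x⟫ = 0) (b x : E3) :
    ⟪cross b x, gradient G x⟫ = 0 := by
  by_cases hax : cross a x = 0
  swap
  · exact inner_cross_eq_zero_of_meridional hax (hrot x hax) (hmer x hax) b
  obtain ⟨u, hu⟩ := exists_dir_cross_ne_zero ha
  -- along the line `x + t u` the point is off the axis for `t ≠ 0`
  have hoff : ∀ t : ℝ, t ≠ 0 → cross a (x + t • u) ≠ 0 := by
    intro t ht h
    rw [KinematicShadow.PointSource.cross_add_right, KinematicShadow.PointSource.cross_smul_right, hax, zero_add] at h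
    rcases smul_eq_zero.1 h with h | h
    · exact ht h
    · exact hu h
  -- the continuous function `t ↦ ⟪b × (x + t u), ∇G(x + t u)⟫` vanishes for `t ≠ 0`, hence at `t = 0`
  have hgc : Continuous (gradient G) := by
    have h1 : Continuous (fderiv ℝ G) := hG.continuous_fderiv one_ne_zero
    exact (toDual ℝ E3).symm.continuous.comp h1
  set f : ℝ → ℝ := fun t => ⟪cross b (x + t • u), gradient G (x + t • u)⟫ with hf
  have hfc : Continuous f := by
    have hline : Continuous (fun t : ℝ => x + t • u) := continuous_const.add (continuous_id.smul continuous_const)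
    have hcr : Continuous (fun t : ℝ => cross b (x + t • u)) := by
      have : (fun t : ℝ => cross b (x + t • u)) = fun t => crossCLM b (x + t • u) := by
        funext t; rw [crossCLM_apply]
      rw [this]
      exact (crossCLM b).continuous.comp hline
    exact hcr.inner (hgc.comp hline)
  have hzero : ∀ t : ℝ, t ≠ 0 → f t = 0 := fun t ht =>
    inner_cross_eq_zero_of_meridional (hoff t ht) (hrot _ (hoff t ht)) (hmer _ (hoff t ht)) b
  have hclosed : IsClosed {t : ℝ | f t = 0} := isClosed_eq hfc continuous_const
  have hdense : Dense ({0}ᶜ : Set ℝ) := dense_compl_singleton 0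
  have hsub : ({0}ᶜ : Set ℝ) ⊆ {t : ℝ | f t = 0} := fun t ht => hzero t ht
  have hall : {t : ℝ | f t = 0} = univ := by
    have := (hdense.mono hsub).closure_eq
    rwa [hclosed.closure_eq] at this
  have h0 : f 0 = 0 := by
    have : (0 : ℝ) ∈ {t : ℝ | f t = 0} := by rw [hall]; trivial
    exact this
  simpa [hf] using h0

/-- **Constancy on spheres** from rotation invariance about every axis (`G` differentiable). [folklore] -/
theorem sphereConst_of_rotInvariant_all {G : E3 → ℝ} (hG : Differentiable ℝ G)
    (hrot : ∀ b x : E3, ⟪cross b x, gradient G x⟫ = 0) {y y' : E3} (hnorm : ‖y‖ = ‖y'‖) : G y = G y' := by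
  obtain ⟨n, hn, hyn⟩ := Literature.Analysis.Calculus.exists_unit_orthogonal (E := E3)
    (by rw [finrank_euclideanSpace_fin]; norm_num) (y - y')
  have hinner : ⟪n, y⟫ = ⟪n, y'⟫ := by
    rw [inner_sub_left, sub_eq_zero] at hyn
    rw [real_inner_comm y n, real_inner_comm y' n]
    exact hyn
  exact eq_of_inner_cross_gradient_eq_zero hG (hrot n) hn hnorm hinner

/-- ★ **A `C¹` function, homogeneous of ODD degree under all real dilations, zonal about `a ≠ 0` and with vanishing meridional
derivative off the axis, is identically zero.**  (Constant on spheres, and `G(−y) = (−1)ⁿ G(y) = −G(y)`.) [folklore] -/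
theorem eq_zero_of_zonal_meridional_odd {G : E3 → ℝ} {a : E3} {n : ℕ} (ha : a ≠ 0) (hn : Odd n) (hG : ContDiff ℝ 1 G)
    (hhom : ∀ (c : ℝ) (y : E3), G (c • y) = c ^ n * G y)
    (hrot : ∀ x : E3, cross a x ≠ 0 → ⟪gradient G x, cross a x⟫ = 0)
    (hmer : ∀ x : E3, cross a x ≠ 0 → ⟪gradient G x, ‖x‖ ^ 2 • a - ⟪a, x⟫ • x⟫ = 0) (y : E3) : G y = 0 := by
  have hall := rotInvariant_all_of_offAxis ha hG hrot hmer
  have hsph := sphereConst_of_rotInvariant_all (hG.differentiable one_ne_zero) hall (y := y) (y' := -y) (by rw [norm_neg])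
  have hneg : G (-y) = -G y := by
    rw [← neg_one_smul ℝ y, hhom, hn.neg_one_pow]; ring
  linarith [hsph, hneg]

end Meridional

end Summit.NavierStokesRegularity.NavierStokesRegularity.Theorems.PoloidalLiouville.HorizonTower

end
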